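import Summits.CriticalPhenomena.CardyFormulaZ2.Theorems.CardyComplexConeParafermionToSLESixFamiliesDiamondTracePos
import Summits.CriticalPhenomena.CardyFormulaZ2.Theorems.CardyComplexConeParafermionToSLESixFamiliesDiamondIdentifyMesh
import Literature.Probability.LatticeModels.MedialExplorationSideWinding
import HarnessLib

/-!
# The frame attached to a side of a marked diamond: lattice and real coordinates
# (line `potential-darboux-picard-diamond`, S1t `stub_freeSideTurnCount`, part 1)

Crux `ParafermionToSLESixFamilies` (stmt-CriticalPhenomena-11389), line `potential-darboux-picard-diamond`, stub
`stub_freeSideTurnCount` (S1t): the winding of the exploration at the touch darts of a straight free side is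
configuration-independent. The proof constructs, for every touch site, an escape staircase running outside the
diamond back to the start edge (`Literature/…/MedialExplorationVertexEscape.lean`); all four sides are treated at
once in the frame attached to the side. For the side `k : Fin 4` of the frame rectangle (`dParam α β k`,
`…DiamondTraceFrame.lean`, `…DiamondTracePos.lean`; `k = 0, 1, 2, 3`: bottom, right, top, left, counter-clockwise) the lattice direction
`cornerUnit k` points OUT of the diamond across side `k`, the touch darts of the side have orientation `k + 2`,
and:

* `xiC k`, `upC k` — integer coordinates of a lattice site along `cornerUnit k` and `cornerUnit (k + 1)`
  (`xiC_add_unit0`, …, `upC_add_smul3`, `eq_of_xiC_upC`, `abs_xiC_upC_le_iff`);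
* `sideVal_cpos_le`, `sideVal_cpos_extreme` — the side functional `sideVal (k + 2)` of
  `MedialExplorationSideWinding` at a corner `(v, m)` is at most `xiC k v - upC k v + cK k`, with equality
  minus one at the corner of index `k + 1`;
* `Fk k`, `Gk k`, `gam`, `gam'` — the outward normal and the counter-clockwise tangential coordinate of side
  `k` in the frame and the corresponding half-widths: the open rectangle is `|Fk| < gam ∧ |Gk| < gam'`
  (`box_iff`, `closedBox_iff`, `mem_carrier_iff_frame`), side `k` is `Fk = gam`, `Gk = s - gam'`
  (`Fk_dParam`, `Gk_dParam`), both are `1`-Lipschitz (`abs_Fk_sub_le`, `abs_Gk_sub_le`), and on mesh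
  points they are affine in `xiC ∓ upC` with slope `δ/√2` (`Fk_meshPoint_sub`, `Gk_meshPoint_sub`);
* `dist_dRot` (registered) — the frame map is an isometry;
* the DEFINITIONS of the escape paths built in the sequel files (`…TurnCountEscapePath`, `…TurnCountRoutes`,
  `…TurnCountRouteEast`, `…TurnCountSafe`): the common prefix `prefixPath` / `prefixInit` of the escape of a touch site,
  the three routes `routeBot`, `routeTop`, `routeEast` from the far corner of the box `[-K, K]²` back to the start edge, and
  the predicate `SafeVertex` (a route vertex off the prefix), all in the coordinates `xiC k`, `upC k`.
-/

noncomputable section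

namespace Summit.CriticalPhenomena.CardyFormulaZ2.Cruxes.ParafermionToSLESixFamilies.PotentialDarbouxPicardDiamond

open Set Metric Complex
open Literature.Probability Literature.Probability.LatticeModels
open Literature.Probability.RandomPlanarGeometry

/-! ## Lattice coordinates attached to the outward direction `k` -/

/-- The coordinate of `v` along `cornerUnit k`: `v₀, v₁, -v₀, -v₁` for `k = 0, 1, 2, 3`. -/
def xiC (k : Fin 4) (v : Site 2) : ℤ := ![v 0, v 1, -(v 0), -(v 1)] k

/-- The coordinate of `v` along `cornerUnit (k + 1)`: `v₁, -v₀, -v₁, v₀` for `k = 0, 1, 2, 3`. -/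
def upC (k : Fin 4) (v : Site 2) : ℤ := ![v 1, -(v 0), -(v 1), v 0] k

/-- The additive constant in the side functional: `0, 0, 1, 1`. -/
def cK (k : Fin 4) : ℤ := ![0, 0, 1, 1] k

variable (k : Fin 4) (v : Site 2)

/-- A step `cornerUnit k` raises `xiC` by one. -/
@[simp] theorem xiC_add_unit0 : xiC k (v + cornerUnit k) = xiC k v + 1 := by
  fin_cases k <;> simp [xiC, cornerUnit] <;> omega

/-- A step `cornerUnit k` keeps `upC`. -/
@[simp] theorem upC_add_unit0 : upC k (v + cornerUnit k) = upC k v := by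
  fin_cases k <;> simp [upC, cornerUnit]

/-- A step `cornerUnit (k+1)` keeps `xiC`. -/
@[simp] theorem xiC_add_unit1 : xiC k (v + cornerUnit (k + 1)) = xiC k v := by
  fin_cases k <;> simp [xiC, cornerUnit]

/-- A step `cornerUnit (k+1)` raises `upC` by one. -/
@[simp] theorem upC_add_unit1 : upC k (v + cornerUnit (k + 1)) = upC k v + 1 := by
  fin_cases k <;> simp [upC, cornerUnit] <;> omega

/-- A step `cornerUnit (k+2)` lowers `xiC` by one. -/
@[simp] theorem xiC_add_unit2 : xiC k (v + cornerUnit (k + 2)) = xiC k v - 1 := by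
  fin_cases k <;> simp [xiC, cornerUnit] <;> omega

/-- A step `cornerUnit (k+2)` keeps `upC`. -/
@[simp] theorem upC_add_unit2 : upC k (v + cornerUnit (k + 2)) = upC k v := by
  fin_cases k <;> simp [upC, cornerUnit]

/-- A step `cornerUnit (k+3)` keeps `xiC`. -/
@[simp] theorem xiC_add_unit3 : xiC k (v + cornerUnit (k + 3)) = xiC k v := by
  fin_cases k <;> simp [xiC, cornerUnit]

/-- A step `cornerUnit (k+3)` lowers `upC` by one. -/
@[simp] theorem upC_add_unit3 : upC k (v + cornerUnit (k + 3)) = upC k v - 1 := by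
  fin_cases k <;> simp [upC, cornerUnit] <;> omega

/-- `n` steps `cornerUnit k` raise `xiC` by `n`. -/
@[simp] theorem xiC_add_smul0 (n : ℤ) : xiC k (v + n • cornerUnit k) = xiC k v + n := by
  fin_cases k <;> simp [xiC, cornerUnit] <;> omega

/-- `n` steps `cornerUnit k` keep `upC`. -/
@[simp] theorem upC_add_smul0 (n : ℤ) : upC k (v + n • cornerUnit k) = upC k v := by
  fin_cases k <;> simp [upC, cornerUnit]

/-- `n` steps `cornerUnit (k+1)` keep `xiC`. -/
@[simp] theorem xiC_add_smul1 (n : ℤ) : xiC k (v + n • cornerUnit (k + 1)) = xiC k v := by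
  fin_cases k <;> simp [xiC, cornerUnit]

/-- `n` steps `cornerUnit (k+1)` raise `upC` by `n`. -/
@[simp] theorem upC_add_smul1 (n : ℤ) : upC k (v + n • cornerUnit (k + 1)) = upC k v + n := by
  fin_cases k <;> simp [upC, cornerUnit] <;> omega

/-- `n` steps `cornerUnit (k+2)` lower `xiC` by `n`. -/
@[simp] theorem xiC_add_smul2 (n : ℤ) : xiC k (v + n • cornerUnit (k + 2)) = xiC k v - n := by
  fin_cases k <;> simp [xiC, cornerUnit] <;> omega

/-- `n` steps `cornerUnit (k+2)` keep `upC`. -/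
@[simp] theorem upC_add_smul2 (n : ℤ) : upC k (v + n • cornerUnit (k + 2)) = upC k v := by
  fin_cases k <;> simp [upC, cornerUnit]

/-- `n` steps `cornerUnit (k+3)` keep `xiC`. -/
@[simp] theorem xiC_add_smul3 (n : ℤ) : xiC k (v + n • cornerUnit (k + 3)) = xiC k v := by
  fin_cases k <;> simp [xiC, cornerUnit]

/-- `n` steps `cornerUnit (k+3)` lower `upC` by `n`. -/
@[simp] theorem upC_add_smul3 (n : ℤ) : upC k (v + n • cornerUnit (k + 3)) = upC k v - n := by
  fin_cases k <;> simp [upC, cornerUnit] <;> omega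

/-- The two coordinates determine the site. -/
theorem eq_of_xiC_upC {k : Fin 4} {v w : Site 2} (h1 : xiC k v = xiC k w) (h2 : upC k v = upC k w) : v = w := by
  ext i
  fin_cases k <;> fin_cases i <;> simp [xiC, upC] at h1 h2 ⊢ <;> omega

/-- Sup-norm bounds in the two frames agree. -/
theorem abs_xiC_upC_le_iff (B : ℤ) : (|xiC k v| ≤ B ∧ |upC k v| ≤ B) ↔ (|v 0| ≤ B ∧ |v 1| ≤ B) := by
  fin_cases k <;> simp [xiC, upC, abs_le] <;> omega

/-- Differences of coordinates of lattice neighbours in a common face: at most one. -/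
theorem abs_xiC_upC_sub_le_one {k : Fin 4} {v w : Site 2} (h : ∀ i, |w i - v i| ≤ 1) :
    |xiC k w - xiC k v| ≤ 1 ∧ |upC k w - upC k v| ≤ 1 := by
  have h0 := h 0
  have h1 := h 1
  rw [abs_le] at h0 h1
  fin_cases k <;> simp [xiC, upC, abs_le] <;> omega

/-! ## The escape paths: prefix, routes, safe vertices (definitions; their bookkeeping is in the sequel files) -/

/-- The common prefix of the escape paths of the touch site `u` (side with outward direction `k`, far size `K`):
`[S, E, E] ++ E^{K - xiC u - 2} ++ S^{upC u - 1 + K}`. -/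
def prefixPath (k : Fin 4) (u : Site 2) (K : ℤ) : List (Fin 4) :=
  [k + 3, k, k] ++ List.replicate (K - xiC k u - 2).toNat k ++ List.replicate (upC k u - 1 + K).toNat (k + 3)

/-- The prefix without its last step. -/
def prefixInit (k : Fin 4) (u : Site 2) (K : ℤ) : List (Fin 4) :=
  [k + 3, k, k] ++ List.replicate (K - xiC k u - 2).toNat k ++ List.replicate ((upC k u - 1 + K).toNat - 1) (k + 3)

/-- A route vertex `b` is SAFE for the touch site `u` (side `k`, far size `K`, indicator `ι`): either it is an outside
site (`ι b = 0`) off the outward spur row `upC = upC u - 1, xiC ≥ xiC u + 1` and off the far column `xiC = K` above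
`-K`, or it is a diamond site (`ι b = 1`) outside the block `{xiC u, xiC u + 1} × {upC u - 1, upC u}`. -/
def SafeVertex (k : Fin 4) (u : Site 2) (K : ℤ) (ι : Site 2 → ℤ) (b : Site 2) : Prop :=
  (ι b = 0 ∧ ¬ (upC k b = upC k u - 1 ∧ xiC k u + 1 ≤ xiC k b ∧ xiC k b ≤ K - 1) ∧
      ¬ (xiC k b = K ∧ -K + 1 ≤ upC k b ∧ upC k b ≤ upC k u - 1)) ∨
    (ι b = 1 ∧ ¬ (xiC k u ≤ xiC k b ∧ xiC k b ≤ xiC k u + 1 ∧ upC k u - 1 ≤ upC k b ∧ upC k b ≤ upC k u))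

/-- The bottom route from the far corner to `p` and on along the gadget `gds`: `W^{K - xiC p} ++ N^{upC p + K} ++ gds`. -/
def routeBot (k : Fin 4) (K : ℤ) (p : Site 2) (gds : List (Fin 4)) : List (Fin 4) :=
  List.replicate (K - xiC k p).toNat (k + 2) ++ List.replicate (upC k p + K).toNat (k + 1) ++ gds

/-- The top route from the far corner to `p` and on along the gadget `gds`:
`W^{2K} ++ N^{2K} ++ E^{xiC p + K} ++ S^{K - upC p} ++ gds`. -/
def routeTop (k : Fin 4) (K : ℤ) (p : Site 2) (gds : List (Fin 4)) : List (Fin 4) :=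
  List.replicate (2 * K).toNat (k + 2) ++ List.replicate (2 * K).toNat (k + 1) ++ List.replicate (xiC k p + K).toNat k ++
    List.replicate (K - upC k p).toNat (k + 3) ++ gds

/-- The east route from the far corner to `p` and on along the gadget `gds`:
`W^{2K} ++ N^{2K} ++ E^{2K} ++ S^{K - upC p} ++ W^{K - xiC p} ++ gds`. -/
def routeEast (k : Fin 4) (K : ℤ) (p : Site 2) (gds : List (Fin 4)) : List (Fin 4) :=
  List.replicate (2 * K).toNat (k + 2) ++ List.replicate (2 * K).toNat (k + 1) ++ List.replicate (2 * K).toNat k ++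
    List.replicate (K - upC k p).toNat (k + 3) ++ List.replicate (K - xiC k p).toNat (k + 2) ++ gds

/-! ## The side functional in the frame -/

/-- **The side functional of orientation `k + 2` at any corner at `v` is at most `xiC k v - upC k v + cK k`.** -/
theorem sideVal_cpos_le (m : Fin 4) : sideVal (k + 2) (cpos (v, m)) ≤ xiC k v - upC k v + cK k := by
  fin_cases k <;> fin_cases m <;> simp [sideVal, cpos, cposOff, xiC, upC, cK] <;> omega

/-- **At the corner of index `k + 1` the side functional equals `xiC k v - upC k v - 1 + cK k`.** -/
theorem sideVal_cpos_extreme : sideVal (k + 2) (cpos (v, k + 1)) = xiC k v - upC k v - 1 + cK k := by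
  fin_cases k <;> simp [sideVal, cpos, cposOff, xiC, upC, cK] <;> omega

/-! ## Real coordinates of the frame attached to side `k` -/

/-- The outward normal coordinate of side `k` in the frame: `-Im, Re, Im, -Re`. -/
def Fk (k : Fin 4) (w : ℂ) : ℝ := ![-w.im, w.re, w.im, -w.re] k

/-- The counter-clockwise tangential coordinate of side `k` in the frame: `Re, Im, -Re, -Im`. -/
def Gk (k : Fin 4) (w : ℂ) : ℝ := ![w.re, w.im, -w.re, -w.im] k

/-- The half-width of the rectangle across side `k`: `β, α, β, α`. -/
def gam (α β : ℝ) (k : Fin 4) : ℝ := ![β, α, β, α] k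

/-- The half-length of side `k`: `α, β, α, β`. -/
def gam' (α β : ℝ) (k : Fin 4) : ℝ := ![α, β, α, β] k

variable {k}
variable {α β : ℝ}

/-- `gam` is positive. -/
theorem gam_pos (hα : 0 < α) (hβ : 0 < β) (k : Fin 4) : 0 < gam α β k := by
  fin_cases k <;> simp [gam, hα, hβ]

/-- `gam'` is positive. -/
theorem gam'_pos (hα : 0 < α) (hβ : 0 < β) (k : Fin 4) : 0 < gam' α β k := by
  fin_cases k <;> simp [gam', hα, hβ]

/-- `min α β ≤ gam`. -/
theorem min_le_gam (α β : ℝ) (k : Fin 4) : min α β ≤ gam α β k := by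
  fin_cases k <;> simp [gam]

/-- The side length is twice `gam'`. -/
theorem dLen_eq (α β : ℝ) (k : Fin 4) : dLen α β k = 2 * gam' α β k := by
  fin_cases k <;> simp [dLen, gam']

/-- **The open frame rectangle in the coordinates of side `k`.** -/
theorem box_iff (k : Fin 4) (w : ℂ) : (|w.re| < α ∧ |w.im| < β) ↔ (|Fk k w| < gam α β k ∧ |Gk k w| < gam' α β k) := by
  fin_cases k <;> simp [Fk, Gk, gam, gam', abs_neg, and_comm]

/-- The closed frame rectangle in the coordinates of side `k`. -/
theorem closedBox_iff (k : Fin 4) (w : ℂ) : (|w.re| ≤ α ∧ |w.im| ≤ β) ↔ (|Fk k w| ≤ gam α β k ∧ |Gk k w| ≤ gam' α β k) := by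
  fin_cases k <;> simp [Fk, Gk, gam, gam', abs_neg, and_comm]

/-- `Fk` is additive. -/
theorem Fk_sub (k : Fin 4) (w w' : ℂ) : Fk k (w - w') = Fk k w - Fk k w' := by
  fin_cases k <;> simp [Fk] <;> ring

/-- `Gk` is additive. -/
theorem Gk_sub (k : Fin 4) (w w' : ℂ) : Gk k (w - w') = Gk k w - Gk k w' := by
  fin_cases k <;> simp [Gk] <;> ring

/-- `Fk` is bounded by the norm. -/
theorem abs_Fk_le_norm (k : Fin 4) (w : ℂ) : |Fk k w| ≤ ‖w‖ := by
  fin_cases k <;> simp [Fk, abs_neg, Complex.abs_re_le_norm, Complex.abs_im_le_norm]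

/-- `Gk` is bounded by the norm. -/
theorem abs_Gk_le_norm (k : Fin 4) (w : ℂ) : |Gk k w| ≤ ‖w‖ := by
  fin_cases k <;> simp [Gk, abs_neg, Complex.abs_re_le_norm, Complex.abs_im_le_norm]

/-- **`Fk` is `1`-Lipschitz.** -/
theorem abs_Fk_sub_le (k : Fin 4) (w w' : ℂ) : |Fk k w - Fk k w'| ≤ ‖w - w'‖ := by
  rw [← Fk_sub]; exact abs_Fk_le_norm k _

/-- **`Gk` is `1`-Lipschitz.** -/
theorem abs_Gk_sub_le (k : Fin 4) (w w' : ℂ) : |Gk k w - Gk k w'| ≤ ‖w - w'‖ := by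
  rw [← Gk_sub]; exact abs_Gk_le_norm k _

/-- **Side `k` is the line `Fk = gam`**, parametrised by `Gk = s - gam'`. -/
theorem Fk_dParam (α β : ℝ) (k : Fin 4) (s : ℝ) : Fk k (dParam α β k s) = gam α β k := by
  fin_cases k <;> simp [Fk, dParam, dCorner, dDir, gam]

/-- The tangential coordinate along side `k`. -/
theorem Gk_dParam (α β : ℝ) (k : Fin 4) (s : ℝ) : Gk k (dParam α β k s) = s - gam' α β k := by
  fin_cases k <;> simp [Gk, dParam, dCorner, dDir, gam'] <;> ring

/-- The side directions are unit vectors. -/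
theorem norm_dDir (k : Fin 4) : ‖dDir k‖ = 1 := by
  fin_cases k <;> simp [dDir]

/-- Distances along a side are differences of arc length. -/
theorem dist_dParam (α β : ℝ) (k : Fin 4) (s t : ℝ) : dist (dParam α β k t) (dParam α β k s) = |t - s| := by
  rw [dist_eq_norm, dParam_sub, norm_mul, norm_dDir, mul_one, Complex.norm_real, Real.norm_eq_abs]

/-! ## The frame map -/

/-- **The frame map is an isometry** (registered helper of `stub_freeSideTurnCount`). -/
theorem dist_dRot : ∀ (c z w : ℂ), dist (dRot c z) (dRot c w) = dist z w := by
  intro c z w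
  rw [dist_eq_norm, dist_eq_norm, dRot_sub, norm_mul, norm_exp_neg_pi_div_four_mul_I, mul_one]

/-- The frame map is affine: it commutes with line maps. -/
theorem dRot_lineMap (c p q : ℂ) (θ : ℝ) :
    dRot c (AffineMap.lineMap p q θ) = AffineMap.lineMap (dRot c p) (dRot c q) θ := by
  simp only [AffineMap.lineMap_apply_module, dRot]
  simp only [Complex.real_smul]
  push_cast
  ring

/-- The inverse frame map is affine: it commutes with line maps. -/
theorem dRotInv_lineMap (c p q : ℂ) (θ : ℝ) :
    dRotInv c (AffineMap.lineMap p q θ) = AffineMap.lineMap (dRotInv c p) (dRotInv c q) θ := by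
  simp only [AffineMap.lineMap_apply_module, dRotInv]
  simp only [Complex.real_smul]
  push_cast
  ring

/-- **Mesh points in the frame of side `k`, normal coordinate**: differences are `δ/√2 · Δ(xiC - upC)`. -/
theorem Fk_meshPoint_sub (c : ℂ) (δ : ℝ) (k : Fin 4) (v w : Site 2) :
    Fk k (dRot c (meshPoint δ v)) - Fk k (dRot c (meshPoint δ w)) =
      Real.sqrt 2 / 2 * δ * ((xiC k v - upC k v - (xiC k w - upC k w) : ℤ) : ℝ) := by
  obtain ⟨h1, h2⟩ := tilt_meshPoint δ c v
  obtain ⟨h3, h4⟩ := tilt_meshPoint δ c w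
  have A : (dRot c (meshPoint δ v)).re = _ := h1
  have B : (dRot c (meshPoint δ v)).im = _ := h2
  have A' : (dRot c (meshPoint δ w)).re = _ := h3
  have B' : (dRot c (meshPoint δ w)).im = _ := h4
  fin_cases k <;> simp [Fk, xiC, upC, A, B, A', B'] <;> ring

/-- **Mesh points in the frame of side `k`, tangential coordinate**: differences are `δ/√2 · Δ(xiC + upC)`. -/
theorem Gk_meshPoint_sub (c : ℂ) (δ : ℝ) (k : Fin 4) (v w : Site 2) :
    Gk k (dRot c (meshPoint δ v)) - Gk k (dRot c (meshPoint δ w)) =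
      Real.sqrt 2 / 2 * δ * ((xiC k v + upC k v - (xiC k w + upC k w) : ℤ) : ℝ) := by
  obtain ⟨h1, h2⟩ := tilt_meshPoint δ c v
  obtain ⟨h3, h4⟩ := tilt_meshPoint δ c w
  have A : (dRot c (meshPoint δ v)).re = _ := h1
  have B : (dRot c (meshPoint δ v)).im = _ := h2
  have A' : (dRot c (meshPoint δ w)).re = _ := h3
  have B' : (dRot c (meshPoint δ w)).im = _ := h4
  fin_cases k <;> simp [Gk, xiC, upC, A, B, A', B'] <;> ring

/-- `√2/2 · δ` lies between `δ/2` and `δ`. -/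
theorem sqrt_two_div_two_mul_bounds {δ : ℝ} (hδ : 0 < δ) : δ / 2 < Real.sqrt 2 / 2 * δ ∧ Real.sqrt 2 / 2 * δ < δ := by
  have h1 : 1 < Real.sqrt 2 := by
    rw [show (1:ℝ) = Real.sqrt 1 by simp]; exact Real.sqrt_lt_sqrt (by norm_num) (by norm_num)
  have h2 : Real.sqrt 2 < 2 := by
    rw [show (2:ℝ) = Real.sqrt 4 by rw [show (4:ℝ) = 2 ^ 2 by norm_num, Real.sqrt_sq (by norm_num)]]
    exact Real.sqrt_lt_sqrt (by norm_num) (by norm_num)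
  constructor <;> nlinarith

section Diamond

variable {D : DobrushinDomain} {c : ℂ}

/-- **The carrier of a marked diamond in the coordinates of side `k`.** -/
theorem mem_carrier_iff_frame (hD : D.carrier = {z | |(dRot c z).re| < α ∧ |(dRot c z).im| < β}) (k : Fin 4)
    (z : ℂ) : z ∈ D.carrier ↔ |Fk k (dRot c z)| < gam α β k ∧ |Gk k (dRot c z)| < gam' α β k := by
  rw [hD, Set.mem_setOf_eq, box_iff k]

/-- A point beyond one of the four sides is outside the carrier. -/
theorem not_mem_carrier_of_frame (hD : D.carrier = {z | |(dRot c z).re| < α ∧ |(dRot c z).im| < β}) (k : Fin 4)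
    {z : ℂ} (h : gam α β k ≤ Fk k (dRot c z) ∨ Fk k (dRot c z) ≤ -gam α β k ∨ gam' α β k ≤ Gk k (dRot c z) ∨
      Gk k (dRot c z) ≤ -gam' α β k) : z ∉ D.carrier := by
  rw [mem_carrier_iff_frame hD k, abs_lt, abs_lt]
  rintro ⟨⟨h1, h2⟩, h3, h4⟩
  rcases h with h | h | h | h <;> linarith

/-- Frontier points of the carrier lie on the boundary of the closed frame rectangle, in the coordinates of
side `k`. -/
theorem frame_of_mem_frontier (hD : D.carrier = {z | |(dRot c z).re| < α ∧ |(dRot c z).im| < β}) (k : Fin 4)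
    {z : ℂ} (hz : z ∈ frontier D.carrier) :
    |Fk k (dRot c z)| ≤ gam α β k ∧ |Gk k (dRot c z)| ≤ gam' α β k ∧
      (|Fk k (dRot c z)| = gam α β k ∨ |Gk k (dRot c z)| = gam' α β k) := by
  obtain ⟨h1, h2, h3⟩ := bdry_of_mem_frontier hD hz
  rw [box_iff k] at h3
  obtain ⟨h4, h5⟩ := (closedBox_iff k _).1 ⟨h1, h2⟩
  refine ⟨h4, h5, ?_⟩
  by_contra h
  rw [not_or] at h
  exact h3 ⟨lt_of_le_of_ne h4 h.1, lt_of_le_of_ne h5 h.2⟩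

end Diamond

end Summit.CriticalPhenomena.CardyFormulaZ2.Cruxes.ParafermionToSLESixFamilies.PotentialDarbouxPicardDiamond

end
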